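import Mathlib
import Literature.Topology.FourManifolds.PlanarAchiralWords
import Literature.Topology.FourManifolds.PlanarShadowWalk
import Summits.SmoothPoincare4.SmoothPoincare4.Theorems.ConvexBisectionPlanarAcyclicBisectionRigidityHelperConjugationThree
import Summits.SmoothPoincare4.SmoothPoincare4.Theorems.ConvexBisectionPlanarAcyclicBisectionRigidityStubK4Lift
import HarnessLib

/-!
# Crux `ConvexBisection.PlanarAcyclicBisectionRigidity`, line Sketch (v3.0) — helper
# `twoHoleTwist_normalForm3`: normal form of two-hole twists on three holes

Pure algebra on the definitions of `Literature/Topology/FourManifolds/PlanarAchiralWords.lean` and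
the round sub-alphabet `IsXYGen` of `PlanarShadowWalk.lean`, on top of the conjugation table of
`…HelperConjugationThree` (sub-namespace `Conj3`: `mul_holeTwist`, `evalWord_comm_outer`, the table
`conj_sigma*_T*`, the `{0,2}`-twist `T_z = σ₁ T_[0,1] σ₁⁻¹`) and the group of units of the on-the-nose
monoid `ArcData 3` of `…HelperReachMon` (`ReachMon.U n g`, the unit of the word `g`).

* THE `α`-NORMALISATION OF CARRIERS (`twoHoleTwist_normalForm3`): the positive Dehn twist about ANY
  curve `g(c_[a,a+1])` of two-hole type on three holes (`g` any word in `σ₀^{±}, σ₁^{±}, T_[a,b]^{±}`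
  supported on the three holes) equals, as arc data, the positive twist about `h(c_[0,1])`, `h(c_[1,2])`
  or `h(σ₁(c_[0,1]))` for a word `h` in the round sub-alphabet `T_[0,1]^{±}, T_[1,2]^{±}`.
* Mechanism (sub-namespace `Conj3`, section `NF`): `K = ⟨T_[0,1], T_[1,2]⟩ · ⟨C⟩`
  (`C = T_[0,2] T_[0,0] T_[1,1] T_[2,2]`, central: `Conj3.commute_C`) receives the conjugates of the
  sub-alphabet by the half-twists (`Conj3.conj_sigma_xy_mem_K3`, from the table (T2)); the set `NF3` of
  `⟨T_[0,1], T_[1,2]⟩`-conjugates of the base twists `T_[0,1]`, `T_[1,2]`, `T_z` is stable under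
  conjugation by every supported generator (`Conj3.nf_step`: the base table `Conj3.bTable` for the
  half-twists — `σ₀ : T_[0,1] ↦ T_[0,1], T_[1,2] ↦ T_[0,1] T_z T_[0,1]⁻¹, T_z ↦ T_[1,2]`,
  `σ₁ : T_[0,1] ↦ T_z, T_[1,2] ↦ T_[1,2], T_z ↦ T_[1,2] T_[0,1] T_[1,2]⁻¹`, and their inverses —;
  round twists of the sub-alphabet lengthen the conjugator, the others commute with the whole
  normal form), and the `C`-part of the conjugator drops out because `C` is central.

Uses nothing unproved.
-/

noncomputable section

open Literature.Topology.FourManifolds Literature.Topology.FourManifolds.PlanarWords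

-- the prescribed namespace `Summit.<S>.<P>.…` repeats `SmoothPoincare4` (S = P = SmoothPoincare4)
set_option linter.dupNamespace false

namespace Summit.SmoothPoincare4.SmoothPoincare4.Theorems.PlanarAcyclicBisectionRigidity.Sketch

section NF

open ArcData PGen FreeGroup WalkLow SeamNG ReachMon Literature.Topology.FourManifolds.PlanarShadow

/-- The central word `C = T_[0,2] T_[0,0] T_[1,1] T_[2,2]` (notation local to this file). [folklore] -/
local notation "cW" =>
  ([PGen.round 0 2 false, PGen.round 0 0 false, PGen.round 1 1 false, PGen.round 2 2 false] : List PGen)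

/-- The word `σ₁ T_[0,1] σ₁⁻¹` of the `{0,2}`-twist `T_z` (notation local to this file). [folklore] -/
local notation "zW" => ([PGen.sigma 1 false, PGen.round 0 1 false, PGen.sigma 1 true] : List PGen)

set_option quotPrecheck false in
/-- `K = ⟨T_[0,1], T_[1,2]⟩ · ⟨C⟩`: the units `U_h · C^m` with `h` in the round sub-alphabet (notation
local to this file). [folklore] -/
local notation "K3" => ({k : (ArcData 3)ˣ | ∃ h : List PGen, (∀ q ∈ h, IsXYGen q) ∧
  ∃ m : ℤ, k = ReachMon.U 3 h * ReachMon.U 3 cW ^ m} : Set (ArcData 3)ˣ)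

set_option quotPrecheck false in
/-- The three BASE TWISTS `T_[0,1]`, `T_[1,2]`, `T_z` as units (notation local to this file). [folklore] -/
local notation "Base3" => ({B : (ArcData 3)ˣ | B = ReachMon.U 3 [PGen.round 0 1 false] ∨
  B = ReachMon.U 3 [PGen.round 1 2 false] ∨ B = ReachMon.U 3 zW} : Set (ArcData 3)ˣ)

set_option quotPrecheck false in
/-- NORMAL FORMS: the `⟨T_[0,1], T_[1,2]⟩`-conjugates of the base twists (notation local to this
file). [folklore] -/
local notation "NF3" => ({X : (ArcData 3)ˣ | ∃ h : List PGen, (∀ q ∈ h, IsXYGen q) ∧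
  ∃ B : (ArcData 3)ˣ, B ∈ Base3 ∧ X = ReachMon.U 3 h * B * (ReachMon.U 3 h)⁻¹} : Set (ArcData 3)ˣ)

namespace Conj3

/-! ## Units of words, commutations, the subgroup `K`, base twists and normal forms -/

/-- The unit of the empty word. [folklore] -/
theorem U_nil : U 3 ([] : List PGen) = 1 := Units.ext rfl

/-- The unit of a cons. [folklore] -/
theorem U_cons (p : PGen) (g : List PGen) : U 3 (p :: g) = U 3 [p] * U 3 g := U_append [p] g

/-- Conjugating the unit of a word by the unit of a generator, as one word. [folklore] -/
theorem U_conj (p : PGen) (g : List PGen) : U 3 [p] * U 3 g * (U 3 [p])⁻¹ = U 3 (p :: (g ++ [p.inv])) := by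
  rw [← U_invWord, ← U_append, ← U_append]; rfl

/-- From an identity of words to an identity of conjugated units. [folklore] -/
theorem conj_eq_of_eval {p : PGen} {bw hB bw' : List PGen}
    (e : evalWord 3 (p :: (bw ++ [p.inv])) = evalWord 3 (hB ++ bw' ++ invWord hB)) :
    U 3 [p] * U 3 bw * (U 3 [p])⁻¹ = U 3 hB * U 3 bw' * (U 3 hB)⁻¹ := by
  rw [U_conj, ← U_invWord, ← U_append, ← U_append]; exact Units.ext e

/-- Generators of the round sub-alphabet are supported on the three holes. [folklore] -/
theorem below_of_xy {q : PGen} (hq : IsXYGen q) : q.below 3 = true := by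
  obtain ⟨s, rfl | rfl⟩ := hq <;> rfl

/-- Words in the round sub-alphabet do not permute the holes. [folklore] -/
theorem perm_xy {h : List PGen} (hh : ∀ q ∈ h, IsXYGen q) : (evalWord 3 h).perm = 1 := by
  induction h with
  | nil => rfl
  | cons q h ih =>
    rw [evalWord_cons, mul_perm, ih fun p hp => hh p (List.mem_cons_of_mem q hp), mul_one]
    obtain ⟨s, rfl | rfl⟩ := hh q List.mem_cons_self <;> rfl

/-- Hole twists commute with every unit that does not permute the holes. [folklore] -/
theorem commute_hole (a : ℕ) (ha : a < 3) (s : Bool) (Y : (ArcData 3)ˣ) (hY : (Y : ArcData 3).perm = 1) :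
    Commute (U 3 [round a a s]) Y := by
  have key : Commute (U 3 [round a a false]) Y := by
    rw [Commute, SemiconjBy, Units.ext_iff, Units.val_mul, Units.val_mul]
    show mul (mul (data 3 (round a a false)) one) Y = mul (Y : ArcData 3) (mul (data 3 (round a a false)) one)
    have h := mul_holeTwist (Y : ArcData 3) ⟨a, ha⟩
    simp only [hY, Equiv.Perm.one_apply] at h
    rw [mul_one']; exact h.symm
  cases s
  · exact key
  · rw [show U 3 [round a a true] = (U 3 [round a a false])⁻¹ by rw [← U_invWord]; rfl]
    exact key.inv_left

/-- The outer twist commutes with the unit of every supported word. [folklore] -/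
theorem commute_outer (s : Bool) (g : List PGen) (hg : ∀ q ∈ g, q.below 3 = true) :
    Commute (U 3 [round 0 2 s]) (U 3 g) := by
  have key : Commute (U 3 [round 0 2 false]) (U 3 g) := by
    rw [Commute, SemiconjBy, Units.ext_iff, Units.val_mul, Units.val_mul]
    show mul (mul (data 3 (round 0 2 false)) one) (evalWord 3 g)
      = mul (evalWord 3 g) (mul (data 3 (round 0 2 false)) one)
    rw [mul_one']; exact (evalWord_comm_outer g hg).symm
  cases s
  · exact key
  · rw [show U 3 [round 0 2 true] = (U 3 [round 0 2 false])⁻¹ by rw [← U_invWord]; rfl]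
    exact key.inv_left

/-- `C` commutes with the unit of every supported word that does not permute the holes. [folklore] -/
theorem commute_C (g : List PGen) (hg : ∀ q ∈ g, q.below 3 = true) (hp : (evalWord 3 g).perm = 1) :
    Commute (U 3 cW) (U 3 g) := by
  rw [show cW = [round 0 2 false] ++ [round 0 0 false] ++ [round 1 1 false] ++ [round 2 2 false] from rfl,
    U_append, U_append, U_append]
  exact (((commute_outer false g hg).mul_left (commute_hole 0 (by omega) false _ hp)).mul_left
    (commute_hole 1 (by omega) false _ hp)).mul_left (commute_hole 2 (by omega) false _ hp)

/-- `K` is closed under products (`C` commutes with the sub-alphabet). [folklore] -/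
theorem mul_mem_K3 {a b : (ArcData 3)ˣ} (ha : a ∈ K3) (hb : b ∈ K3) : a * b ∈ K3 := by
  obtain ⟨h, hh, m, rfl⟩ := ha
  obtain ⟨h', hh', m', rfl⟩ := hb
  refine ⟨h ++ h', by simpa [or_imp, forall_and] using And.intro hh hh', m + m', ?_⟩
  have hc : Commute (U 3 cW ^ m) (U 3 h') :=
    (commute_C h' (fun q hq => below_of_xy (hh' q hq)) (perm_xy hh')).zpow_left m
  rw [U_append, zpow_add, mul_assoc, ← mul_assoc (U 3 cW ^ m), hc.eq]; group

/-- `K` is closed under inverses. [folklore] -/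
theorem inv_mem_K3 {a : (ArcData 3)ˣ} (ha : a ∈ K3) : a⁻¹ ∈ K3 := by
  obtain ⟨h, hh, m, rfl⟩ := ha
  refine ⟨invWord h, K4Lift.xy_invWord hh, -m, ?_⟩
  have hc : Commute (U 3 cW ^ (-m)) (U 3 (invWord h)) :=
    (commute_C _ (fun q hq => below_of_xy (K4Lift.xy_invWord hh q hq)) (perm_xy (K4Lift.xy_invWord hh))).zpow_left _
  rw [U_invWord] at hc
  rw [mul_inv_rev, ← zpow_neg, U_invWord]
  exact hc.eq

/-- Table (T2) read in `K`: an identity `p q p⁻¹ = h'` of words. [folklore] -/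
theorem mem_K3_of_eval0 {p q : PGen} {h' : List PGen} (hh' : ∀ x ∈ h', IsXYGen x)
    (e : evalWord 3 [p, q, p.inv] = evalWord 3 h') : U 3 [p] * U 3 [q] * (U 3 [p])⁻¹ ∈ K3 :=
  ⟨h', hh', 0, by rw [U_conj, zpow_zero, mul_one]; exact Units.ext e⟩

/-- Table (T2) read in `K`: an identity `p q p⁻¹ = h' · C` of words. [folklore] -/
theorem mem_K3_of_eval1 {p q : PGen} {h' : List PGen} (hh' : ∀ x ∈ h', IsXYGen x)
    (e : evalWord 3 [p, q, p.inv] = evalWord 3 (h' ++ cW)) : U 3 [p] * U 3 [q] * (U 3 [p])⁻¹ ∈ K3 :=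
  ⟨h', hh', 1, by rw [U_conj, zpow_one, ← U_append]; exact Units.ext e⟩

/-- Conjugating a letter of the round sub-alphabet by a half-twist lands in `K` (table (T2)).
[folklore] -/
theorem conj_sigma_gen_mem_K3 (j : ℕ) (hj : j < 2) (s : Bool) {q : PGen} (hq : IsXYGen q) :
    U 3 [sigma j s] * U 3 [q] * (U 3 [sigma j s])⁻¹ ∈ K3 := by
  have hx : ∀ x ∈ [round 0 1 false], IsXYGen x := by simp [IsXYGen]
  have hy : ∀ x ∈ [round 1 2 false], IsXYGen x := by simp [IsXYGen]
  have hxy : ∀ x ∈ [round 0 1 true, round 1 2 true], IsXYGen x := by simp [IsXYGen]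
  have hyx : ∀ x ∈ [round 1 2 true, round 0 1 true], IsXYGen x := by simp [IsXYGen]
  -- the positive letters, from the table
  have p01 : U 3 [sigma j s] * U 3 [round 0 1 false] * (U 3 [sigma j s])⁻¹ ∈ K3 := by
    interval_cases j
    · exact mem_K3_of_eval0 hx (conj_sigma0_T01 s)
    · cases s
      · exact mem_K3_of_eval1 hxy conj_sigma1_T01
      · exact mem_K3_of_eval1 hyx conj_sigma1inv_T01
  have p12 : U 3 [sigma j s] * U 3 [round 1 2 false] * (U 3 [sigma j s])⁻¹ ∈ K3 := by
    interval_cases j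
    · cases s
      · exact mem_K3_of_eval1 hyx conj_sigma0_T12
      · exact mem_K3_of_eval1 hxy conj_sigma0inv_T12
    · exact mem_K3_of_eval0 hy (conj_sigma1_T12 s)
  -- the negative letters, by inversion
  have neg : ∀ a b : ℕ, U 3 [sigma j s] * U 3 [round a b false] * (U 3 [sigma j s])⁻¹ ∈ K3 →
      U 3 [sigma j s] * U 3 [round a b true] * (U 3 [sigma j s])⁻¹ ∈ K3 := fun a b h => by
    have e : U 3 [sigma j s] * U 3 [round a b true] * (U 3 [sigma j s])⁻¹
        = (U 3 [sigma j s] * U 3 [round a b false] * (U 3 [sigma j s])⁻¹)⁻¹ := by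
      rw [show U 3 [round a b true] = (U 3 [round a b false])⁻¹ by rw [← U_invWord]; rfl]; group
    rw [e]; exact inv_mem_K3 h
  obtain ⟨t, rfl | rfl⟩ := hq <;> cases t
  exacts [p01, neg 0 1 p01, p12, neg 1 2 p12]

/-- Conjugating the unit of a word of the round sub-alphabet by a half-twist lands in `K`. [folklore] -/
theorem conj_sigma_xy_mem_K3 (j : ℕ) (hj : j < 2) (s : Bool) {h : List PGen} (hh : ∀ q ∈ h, IsXYGen q) :
    U 3 [sigma j s] * U 3 h * (U 3 [sigma j s])⁻¹ ∈ K3 := by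
  induction h with
  | nil => exact ⟨[], by simp, 0, by simp [U_nil]⟩
  | cons q h ih =>
    have e : U 3 [sigma j s] * U 3 (q :: h) * (U 3 [sigma j s])⁻¹
        = (U 3 [sigma j s] * U 3 [q] * (U 3 [sigma j s])⁻¹) * (U 3 [sigma j s] * U 3 h * (U 3 [sigma j s])⁻¹) := by
      rw [U_cons q h]; group
    rw [e]
    exact mul_mem_K3 (conj_sigma_gen_mem_K3 j hj s (hh q List.mem_cons_self))
      (ih fun p hp => hh p (List.mem_cons_of_mem q hp))

/-- Base twists are units of supported words that do not permute the holes. [folklore] -/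
theorem word_of_mem_Base3 {B : (ArcData 3)ˣ} (hB : B ∈ Base3) :
    ∃ bw : List PGen, (∀ q ∈ bw, q.below 3 = true) ∧ (evalWord 3 bw).perm = 1 ∧ B = U 3 bw := by
  rcases hB with rfl | rfl | rfl
  · exact ⟨[round 0 1 false], by simp [PGen.below], rfl, rfl⟩
  · exact ⟨[round 1 2 false], by simp [PGen.below], rfl, rfl⟩
  · exact ⟨zW, by simp [PGen.below], zTwist_data.1, rfl⟩

/-- The six word identities behind the action of the half-twists on the base twists (engine). [folklore] -/
theorem bTable_ids :
    evalWord 3 [sigma 1 true, round 0 1 false, sigma 1 false]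
      = evalWord 3 [round 0 1 false, sigma 1 false, round 0 1 false, sigma 1 true, round 0 1 true] ∧
    evalWord 3 [sigma 0 false, round 1 2 false, sigma 0 true]
      = evalWord 3 [round 0 1 false, sigma 1 false, round 0 1 false, sigma 1 true, round 0 1 true] ∧
    evalWord 3 [sigma 0 false, sigma 1 false, round 0 1 false, sigma 1 true, sigma 0 true]
      = evalWord 3 [round 1 2 false] ∧
    evalWord 3 [sigma 0 true, sigma 1 false, round 0 1 false, sigma 1 true, sigma 0 false]
      = evalWord 3 [round 0 1 true, round 1 2 false, round 0 1 false] ∧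
    evalWord 3 [sigma 1 false, sigma 1 false, round 0 1 false, sigma 1 true, sigma 1 true]
      = evalWord 3 [round 1 2 false, round 0 1 false, round 1 2 true] ∧
    evalWord 3 [sigma 1 true, sigma 1 false, round 0 1 false, sigma 1 true, sigma 1 false]
      = evalWord 3 [round 0 1 false] := by
  refine ⟨?_, ?_, ?_, ?_, ?_, ?_⟩ <;> refine ext' (by simp [unf3, evalWord_nil]) (fun i => ?_) <;>
    fin_cases i <;> simp [unf3, Equiv.swap_apply_def, evalWord_nil] <;> group

/-- THE BASE TABLE: a half-twist conjugates a base twist to a `⟨T_[0,1], T_[1,2]⟩`-conjugate of a base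
twist (`σ₀: T_[0,1] ↦ T_[0,1], T_[1,2] ↦ T_[0,1] T_z T_[0,1]⁻¹, T_z ↦ T_[1,2]`;
`σ₀⁻¹: T_[1,2] ↦ T_z, T_z ↦ T_[0,1]⁻¹ T_[1,2] T_[0,1]`; `σ₁: T_[0,1] ↦ T_z, T_[1,2] ↦ T_[1,2],
T_z ↦ T_[1,2] T_[0,1] T_[1,2]⁻¹`; `σ₁⁻¹: T_[0,1] ↦ T_[0,1] T_z T_[0,1]⁻¹, T_z ↦ T_[0,1]`). [folklore] -/
theorem bTable (j : ℕ) (hj : j < 2) (s : Bool) {B : (ArcData 3)ˣ} (hB : B ∈ Base3) :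
    ∃ hB : List PGen, (∀ q ∈ hB, IsXYGen q) ∧ ∃ B' : (ArcData 3)ˣ, B' ∈ Base3 ∧
      U 3 [sigma j s] * B * (U 3 [sigma j s])⁻¹ = U 3 hB * B' * (U 3 hB)⁻¹ := by
  obtain ⟨e1, e2, e3, e4, e5, e6⟩ := bTable_ids
  have hx : ∀ t, ∀ x ∈ [round 0 1 t], IsXYGen x := fun t => by simp [IsXYGen]
  have hy : ∀ x ∈ [round 1 2 false], IsXYGen x := by simp [IsXYGen]
  have b01 : U 3 [round 0 1 false] ∈ Base3 := Or.inl rfl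
  have b12 : U 3 [round 1 2 false] ∈ Base3 := Or.inr (Or.inl rfl)
  have bz : U 3 zW ∈ Base3 := Or.inr (Or.inr rfl)
  rcases hB with rfl | rfl | rfl <;> interval_cases j
  · exact ⟨[], by simp, _, b01, conj_eq_of_eval (conj_sigma0_T01 s)⟩
  · cases s
    exacts [⟨[], by simp, _, bz, conj_eq_of_eval rfl⟩, ⟨_, hx false, _, bz, conj_eq_of_eval e1⟩]
  · cases s
    exacts [⟨_, hx false, _, bz, conj_eq_of_eval e2⟩, ⟨[], by simp, _, bz, conj_eq_of_eval zTwist_eq_sigma0inv.symm⟩]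
  · exact ⟨[], by simp, _, b12, conj_eq_of_eval (conj_sigma1_T12 s)⟩
  · cases s
    exacts [⟨[], by simp, _, b12, conj_eq_of_eval e3⟩, ⟨_, hx true, _, b12, conj_eq_of_eval e4⟩]
  · cases s
    exacts [⟨_, hy, _, b01, conj_eq_of_eval e5⟩, ⟨[], by simp, _, b01, conj_eq_of_eval e6⟩]

/-- THE STEP: normal forms are stable under conjugation by every supported generator. [folklore] -/
theorem nf_step (p : PGen) (hp : p.below 3 = true) {X : (ArcData 3)ˣ} (hX : X ∈ NF3) :
    U 3 [p] * X * (U 3 [p])⁻¹ ∈ NF3 := by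
  obtain ⟨h, hh, B, hB, rfl⟩ := hX
  obtain ⟨bw, hbw, hbwp, rfl⟩ := word_of_mem_Base3 hB
  cases p with
  | sigma j s =>
    have hj : j < 2 := by have := hp; simp [PGen.below] at this; omega
    obtain ⟨h', hh', m, e1⟩ := conj_sigma_xy_mem_K3 j hj s hh
    obtain ⟨hB', hhB', B', hB'b, e2⟩ := bTable j hj s hB
    obtain ⟨bw', hbw', hbwp', rfl⟩ := word_of_mem_Base3 hB'b
    refine ⟨h' ++ hB', by simpa [or_imp, forall_and] using And.intro hh' hhB', _, hB'b, ?_⟩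
    have hc : Commute (U 3 cW ^ m) (U 3 hB' * U 3 bw' * (U 3 hB')⁻¹) :=
      (((commute_C _ (fun q hq => below_of_xy (hhB' q hq)) (perm_xy hhB')).mul_right
        (commute_C _ hbw' hbwp')).mul_right
        (commute_C _ (fun q hq => below_of_xy (hhB' q hq)) (perm_xy hhB')).inv_right).zpow_left m
    calc U 3 [sigma j s] * (U 3 h * U 3 bw * (U 3 h)⁻¹) * (U 3 [sigma j s])⁻¹
        = (U 3 [sigma j s] * U 3 h * (U 3 [sigma j s])⁻¹) * (U 3 [sigma j s] * U 3 bw * (U 3 [sigma j s])⁻¹)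
            * (U 3 [sigma j s] * U 3 h * (U 3 [sigma j s])⁻¹)⁻¹ := by group
      _ = U 3 h' * ((U 3 cW ^ m) * (U 3 hB' * U 3 bw' * (U 3 hB')⁻¹) * (U 3 cW ^ m)⁻¹) * (U 3 h')⁻¹ := by
          rw [e1, e2]; group
      _ = U 3 (h' ++ hB') * U 3 bw' * (U 3 (h' ++ hB'))⁻¹ := by rw [hc.eq, mul_inv_cancel_right, U_append]; group
  | round a b s =>
    have hb : b < 3 := by simpa [PGen.below] using hp
    by_cases hxy : IsXYGen (round a b s)
    · exact ⟨round a b s :: h, by simpa using And.intro hxy hh, _, hB, by rw [U_cons (round a b s) h]; group⟩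
    · -- the remaining round twists commute with the whole normal form
      suffices hcomm : Commute (U 3 [round a b s]) (U 3 h * U 3 bw * (U 3 h)⁻¹) by
        exact ⟨h, hh, _, hB, by rw [hcomm.eq, mul_inv_cancel_right]⟩
      have hh3 : ∀ q ∈ h, q.below 3 = true := fun q hq => below_of_xy (hh q hq)
      rcases Nat.lt_or_ge b a with hba | hab
      · rw [show U 3 [round a b s] = 1 from Units.ext (by
          show mul (data 3 (round a b s)) one = one; rw [data_round_degenerate a b s hba, mul_one'])]
        exact Commute.one_left _
      rcases Nat.lt_or_ge a b with hab' | hba'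
      · obtain ⟨rfl, rfl⟩ : a = 0 ∧ b = 2 := by
          interval_cases b <;> interval_cases a <;> simp_all [IsXYGen]
        exact ((commute_outer s h hh3).mul_right (commute_outer s bw hbw)).mul_right
          (commute_outer s h hh3).inv_right
      · obtain rfl : a = b := le_antisymm hab hba'
        exact ((commute_hole a hb s _ (perm_xy hh)).mul_right (commute_hole a hb s _ hbwp)).mul_right
          (commute_hole a hb s _ (perm_xy hh)).inv_right

/-- Normal forms are stable under conjugation by the unit of every supported word. [folklore] -/
theorem nf_conj (g : List PGen) (hg : ∀ q ∈ g, q.below 3 = true) {X : (ArcData 3)ˣ} (hX : X ∈ NF3) :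
    U 3 g * X * (U 3 g)⁻¹ ∈ NF3 := by
  induction g with
  | nil => rw [U_nil, one_mul, inv_one, mul_one]; exact hX
  | cons p g ih =>
    have e : U 3 (p :: g) * X * (U 3 (p :: g))⁻¹ = U 3 [p] * (U 3 g * X * (U 3 g)⁻¹) * (U 3 [p])⁻¹ := by
      rw [U_cons p g]; group
    rw [e]
    exact nf_step p (hg p List.mem_cons_self) (ih fun q hq => hg q (List.mem_cons_of_mem p hq))

/-- The unit of the positive twist word of `⟨a, b, h⟩` is `U_h · T_[a,b] · U_h⁻¹`. [folklore] -/
theorem U_twistWord (a b : ℕ) (h : List PGen) :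
    U 3 ((⟨a, b, h⟩ : PlanarCurve).twistWord true) = U 3 h * U 3 [round a b false] * (U 3 h)⁻¹ := by
  rw [PlanarCurve.twistWord, U_append, U_append, U_invWord]; rfl

/-- The unit of the positive twist word of `⟨0, 1, h · σ₁⟩` is `U_h · T_z · U_h⁻¹`. [folklore] -/
theorem U_twistWord_z (h : List PGen) :
    U 3 ((⟨0, 1, h ++ [sigma 1 false]⟩ : PlanarCurve).twistWord true) = U 3 h * U 3 zW * (U 3 h)⁻¹ := by
  have hz : U 3 zW = U 3 [sigma 1 false] * U 3 [round 0 1 false] * (U 3 [sigma 1 false])⁻¹ := by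
    rw [← U_invWord, ← U_append, ← U_append]; rfl
  rw [PlanarCurve.twistWord, invWord_append, U_append, U_append, U_append, U_append, U_invWord,
    U_invWord, hz]
  simp only [Bool.not_true, mul_assoc]

end Conj3

open Conj3 in
/-- **Helper `twoHoleTwist_normalForm3` — NORMAL FORM OF TWO-HOLE TWISTS on three holes (the
`α`-normalisation of carriers).**  The
positive Dehn twist about ANY curve `g(c_[a,a+1])` of two-hole type (`g` any word in `σ₀^{±}, σ₁^{±},
T_[a,b]^{±}` supported on the three holes) equals, as arc data, the positive twist about `h(c_[0,1])`,
`h(c_[1,2])` or `h(σ₁(c_[0,1]))` for a word `h` in the round sub-alphabet `T_[0,1]^{±}, T_[1,2]^{±}`: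
every two-hole twist is a `⟨T_[0,1], T_[1,2]⟩`-conjugate of `T_[0,1]`, `T_[1,2]` or of the fixed
`{0,2}`-twist `T_z = σ₁ T_[0,1] σ₁⁻¹`.  Induction on `g` (`Conj3.nf_conj`). [folklore] -/
theorem twoHoleTwist_normalForm3 (c : PlanarCurve) (hc : c.InRange 3) (h2 : c.b = c.a + 1) :
    ∃ h : List PGen, (∀ q ∈ h, IsXYGen q) ∧
      (evalWord 3 (c.twistWord true) = evalWord 3 ((⟨0, 1, h⟩ : PlanarCurve).twistWord true) ∨
        evalWord 3 (c.twistWord true) = evalWord 3 ((⟨1, 2, h⟩ : PlanarCurve).twistWord true) ∨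
        evalWord 3 (c.twistWord true)
          = evalWord 3 ((⟨0, 1, h ++ [PGen.sigma 1 false]⟩ : PlanarCurve).twistWord true)) := by
  obtain ⟨a, b, g⟩ := c
  obtain ⟨hab, hb, hg⟩ := hc
  simp only at hab hb hg h2
  subst h2
  have ha : a < 2 := by omega
  have hbase : U 3 [round a (a + 1) false] ∈ Base3 := by
    interval_cases a; exacts [Or.inl rfl, Or.inr (Or.inl rfl)]
  obtain ⟨h, hh, B, hB, e⟩ :=
    nf_conj g hg (X := U 3 [round a (a + 1) false]) ⟨[], by simp, _, hbase, by simp [U_nil]⟩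
  rw [← U_twistWord] at e
  refine ⟨h, hh, ?_⟩
  have val : ∀ w w' : List PGen, U 3 w = U 3 w' → evalWord 3 w = evalWord 3 w' :=
    fun w w' hw => congrArg Units.val hw
  rcases hB with rfl | rfl | rfl
  · exact .inl (val _ _ (e.trans (U_twistWord 0 1 h).symm))
  · exact .inr (.inl (val _ _ (e.trans (U_twistWord 1 2 h).symm)))
  · exact .inr (.inr (val _ _ (e.trans (U_twistWord_z h).symm)))

end NF

end Summit.SmoothPoincare4.SmoothPoincare4.Theorems.PlanarAcyclicBisectionRigidity.Sketch

end
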